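import Literature.Analysis.ODE.MaximalTime
import Summits.NavierStokesRegularity.NavierStokesRegularity.Theorems.PerpetualPumpAveragedTypeIBlowupPreviousPairRelax

/-!
# Crux `PerpetualPump.AveragedTypeIBlowup` (stmt-NavierStokesRegularity-1835), line `Sketch`:
# stub `previousPair` — the pair behind the front after a hand-off (bootstrap closed)

This file proves the registered stub `stub_previousPair` of the line skeleton
`Cruxes/AveragedTypeIBlowup/Lines/Sketch.lean` (G4', Mathlib + the folklore maximal-time tool
`Literature.Analysis.ODE.maximalTimeP`), and its truncated companion `stub_previousPairTrunc`.

Setting (slow time `σ` of the new front scale, relative rate `κ = q⁻⁴ ∈ [4/5, 1]` of the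
previous scale): right after a hand-off the new front carrier is `b ≈ B e^{-σ}` (known on
`[0, σI]`), and the PREVIOUS pair — carrier `bp` and spent bond `wp` one scale below — starts at
`bp(0) = q⁴/2 + (P−R)/2 ∈ [q⁴/2 − 3/20, q⁴/2 + 1/10]`, `wp(0)² = q³B ± 1`, and solves
`bp' = κ(-bp - wp² + wl² - εb bp wp) + e0`, `wp' = κ(wp(bp - b/q - 1) + εb bp²) + e1`
with memory errors `|eᵢ| ≤ ηκ mᵢ` controlled by Duhamel majorants. Conclusions: (A) on the whole
window `-ω ≤ wp`, `wp² ≤ q³B + 2`, `-2/5 ≤ bp ≤ 17/20`; (B) after `σI`, `|wp| ≤ ω/2` and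
`bp ≤ 3/10`; (C) the transfer `κ∫₀^σ wp² ≤ 9/10`.

Proof: a bootstrap ("continuity argument") on the tube `-1/2 ≤ bp ≤ 9/10`,
`bp ≤ 2/5` after `σI`, `m1 ≤ μ + 3√B`, `κ∫wp² ≤ 1`. Inside the tube the files
`…PreviousPairRates/Bond/Dump/Carrier/Relax` prove the sharp bounds
`-3/10 ≤ bp ≤ 77/100`, `bp ≤ 19/100` and `wp² ≤ ω²/4` after `σI`, `m1 ≤ μ + 2√B`,
`κ∫wp² ≤ 16/25` (DUMP of the bond energy at rate `≈ κB/q` during `[0, 30/B]`, decay of `wp` by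
`σI` through the budget `∫₀^{σI} R ≥ 2Λ/3` and `11√B e^{-κΛ/3} ≤ ω`, relaxation of the carrier by
the constant-rate Duhamel formula); by continuity the maximal time of the tube is the full
horizon (`prevPair_tube`), and the conclusions follow (`prevPair_core`).

## References

* T. Tao, *Finite time blowup for an averaged three-dimensional Navier–Stokes equation*, J. Amer.
  Math. Soc. 29 (2016), 601–674, §5–6 (the energy cascade / circuit; the ODE estimates are
  folklore).
-/

noncomputable section

-- the summit namespace `…NavierStokesRegularity.NavierStokesRegularity…` is the tree convention
set_option linter.dupNamespace false
-- every lemma of this file lives inside one `variable … include` context (the bootstrap tube);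
-- not every lemma uses every bundled hypothesis
set_option linter.unusedSectionVars false

open MeasureTheory Set Filter Topology

namespace Summit.NavierStokesRegularity.NavierStokesRegularity.Theorems.PerpetualPumpAveragedTypeIBlowup

section Core

variable {bp wp b m0 m1 wl e0 e1 : ℝ → ℝ} {B Λ κ q θ η εb ω μ σI T : ℝ}

variable (hκq : 4 / 5 ≤ κ ∧ κ ≤ 1 ∧ 1 ≤ q ∧ q ≤ 21 / 20)
  (hsm : 0 ≤ η ∧ 0 < εb ∧ 10 * εb ≤ ω ∧ ω ≤ 1 / 100 ∧ 0 ≤ μ ∧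
    η * (μ + 2 * Real.sqrt B) ≤ ω / 10 ∧ η * μ ≤ 1 / 20 ∧ 1 / 2 ≤ θ ∧ θ ≤ 1)
  (hBT : 1000 ≤ B ∧ 0 < σI ∧ σI ≤ 3 ∧ 0 < T ∧ T ≤ 10)
  (hΛ : 100 ≤ Λ ∧ Λ ≤ B * (1 - Real.exp (-σI)) ∧
    11 * Real.sqrt B * Real.exp (-(κ * Λ / 3)) ≤ ω)
  (hcont : ContinuousOn bp (Icc 0 T) ∧ ContinuousOn wp (Icc 0 T) ∧ ContinuousOn b (Icc 0 T) ∧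
    ContinuousOn m0 (Icc 0 T) ∧ ContinuousOn m1 (Icc 0 T) ∧ ContinuousOn wl (Icc 0 T) ∧
    ContinuousOn e0 (Icc 0 T) ∧ ContinuousOn e1 (Icc 0 T))
  (hode : (∀ σ ∈ Ioo 0 T, HasDerivAt bp
      (κ * (-(bp σ) - (wp σ) ^ 2 + (wl σ) ^ 2 - εb * bp σ * wp σ) + e0 σ) σ) ∧
    (∀ σ ∈ Ioo 0 T, HasDerivAt wp
      (κ * (wp σ * (bp σ - b σ / q - 1) + εb * (bp σ) ^ 2) + e1 σ) σ))
  (herr : (∀ σ ∈ Icc 0 T, |e0 σ| ≤ η * κ * m0 σ) ∧ (∀ σ ∈ Icc 0 T, |e1 σ| ≤ η * κ * m1 σ) ∧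
    (∀ σ ∈ Icc 0 T, 0 ≤ m0 σ ∧ m0 σ ≤ m0 0 * Real.exp (-(θ * κ * σ)) +
      κ * ∫ u in (0 : ℝ)..σ, Real.exp (-(θ * κ * (σ - u))) *
        |-(wp u) ^ 2 + (wl u) ^ 2 - εb * bp u * wp u|) ∧
    (∀ σ ∈ Icc 0 T, 0 ≤ m1 σ ∧ m1 σ ≤ m1 0 * Real.exp (-(θ * κ * σ)) +
      κ * ∫ u in (0 : ℝ)..σ, Real.exp (-(θ * κ * (σ - u))) *
        |wp u * (bp u - b u / q) + εb * (bp u) ^ 2|))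
  (henv : (∀ σ ∈ Icc 0 T, |wl σ| ≤ ω) ∧
    (∀ σ ∈ Icc 0 (min T σI), B * Real.exp (-σ) - 3 ≤ b σ) ∧
    (∀ σ ∈ Icc 0 T, -(1 / 2) ≤ b σ ∧ b σ ≤ B + 3))
  (hini : q ^ 4 / 2 - 3 / 20 ≤ bp 0 ∧ bp 0 ≤ q ^ 4 / 2 + 1 / 10 ∧ 0 ≤ wp 0 ∧
    q ^ 3 * B - 1 ≤ (wp 0) ^ 2 ∧ (wp 0) ^ 2 ≤ q ^ 3 * B + 1 ∧ m0 0 ≤ μ ∧ m1 0 ≤ μ)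

include hκq hsm hBT hΛ hcont hode herr henv hini

/-- **The bootstrap.** The tube conditions (`-1/2 ≤ bp ≤ 9/10`, `bp ≤ 2/5` after `σI`,
`m1 ≤ μ + 3√B`, `κ∫₀^σ wp² ≤ 1`) hold on all of `[0, T]`: they hold at `σ = 0`, they are closed,
and on the maximal time interval the a priori estimates return them with strict inequalities
(`-3/10 ≤ bp ≤ 77/100`, `bp ≤ 19/100` after `σI`, `m1 ≤ μ + 2√B`, `κ∫wp² ≤ 16/25`), so by
continuity the maximal time is `T` (`Literature.Analysis.ODE.maximalTimeP_exit`). [folklore] -/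
theorem prevPair_tube : ∀ σ ∈ Icc 0 T, -(1 / 2) ≤ bp σ ∧ bp σ ≤ 9 / 10 ∧
    (σ ≤ σI ∨ bp σ ≤ 2 / 5) ∧ m1 σ ≤ μ + 3 * Real.sqrt B ∧
    κ * ∫ u in (0 : ℝ)..σ, (wp u) ^ 2 ≤ 1 := by
  have hbpc := hcont.1
  have hwpc := hcont.2.1
  have hm1c := hcont.2.2.2.2.1
  have hT0 : (0 : ℝ) ≤ T := hBT.2.2.2.1.le
  have hσI0 : 0 < σI := hBT.2.1
  have hB : 1000 ≤ B := hBT.1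
  have hsq : 0 < Real.sqrt B := Real.sqrt_pos.2 (by linarith only [hB])
  -- the tube predicate at time `0`
  have hP0 : -(1 / 2) ≤ bp 0 ∧ bp 0 ≤ 9 / 10 ∧ ((0 : ℝ) ≤ σI ∨ bp 0 ≤ 2 / 5) ∧
      m1 0 ≤ μ + 3 * Real.sqrt B ∧ κ * ∫ u in (0 : ℝ)..0, (wp u) ^ 2 ≤ 1 := by
    obtain ⟨-, -, hq1, hq2⟩ := hκq
    obtain ⟨hbp0l, hbp0u, -, -, -, -, hm10⟩ := hini
    have hq4 : q ^ 4 ≤ 194481 / 160000 := by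
      have := pow_le_pow_left₀ (by linarith only [hq1]) hq2 4
      norm_num at this
      exact this
    have hq4' : 1 ≤ q ^ 4 := one_le_pow₀ hq1
    refine ⟨by linarith only [hbp0l, hq4'], by linarith only [hbp0u, hq4], Or.inl hσI0.le,
      by linarith only [hm10, hsq.le], ?_⟩
    rw [intervalIntegral.integral_same, mul_zero]; exact zero_le_one
  -- continuity of the transfer `t ↦ κ ∫₀^t wp²`
  have hQc : ContinuousOn (fun t => κ * ∫ u in (0 : ℝ)..t, (wp u) ^ 2) (Icc 0 T) :=
    continuousOn_const.mul (linearComparison_primitive hT0 (hwpc.pow 2)).1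
  -- closedness from the left
  have hclosed : ∀ t ∈ Ioc 0 T, (∀ s ∈ Ico 0 t, -(1 / 2) ≤ bp s ∧ bp s ≤ 9 / 10 ∧
      (s ≤ σI ∨ bp s ≤ 2 / 5) ∧ m1 s ≤ μ + 3 * Real.sqrt B ∧
      κ * ∫ u in (0 : ℝ)..s, (wp u) ^ 2 ≤ 1) →
      -(1 / 2) ≤ bp t ∧ bp t ≤ 9 / 10 ∧ (t ≤ σI ∨ bp t ≤ 2 / 5) ∧
        m1 t ≤ μ + 3 * Real.sqrt B ∧ κ * ∫ u in (0 : ℝ)..t, (wp u) ^ 2 ≤ 1 := by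
    intro t ht h
    have h' : ∀ s ∈ Ioo 0 t, -(1 / 2) ≤ bp s ∧ bp s ≤ 9 / 10 ∧ (s ≤ σI ∨ bp s ≤ 2 / 5) ∧
        m1 s ≤ μ + 3 * Real.sqrt B ∧ κ * ∫ u in (0 : ℝ)..s, (wp u) ^ 2 ≤ 1 :=
      fun s hs => h s ⟨hs.1.le, hs.2⟩
    refine ⟨previousPair_ge_of_Ioo hbpc le_rfl ht.1 ht.2 fun s hs => (h' s hs).1,
      previousPair_le_of_Ioo hbpc le_rfl ht.1 ht.2 fun s hs => (h' s hs).2.1, ?_,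
      previousPair_le_of_Ioo hm1c le_rfl ht.1 ht.2 fun s hs => (h' s hs).2.2.2.1,
      previousPair_le_of_Ioo (g := fun t => κ * ∫ u in (0 : ℝ)..t, (wp u) ^ 2) hQc le_rfl ht.1
        ht.2 fun s hs => (h' s hs).2.2.2.2⟩
    rcases le_or_gt t σI with htI | htI
    · exact Or.inl htI
    · refine Or.inr (previousPair_le_of_Ioo hbpc hσI0.le htI ht.2 fun s hs => ?_)
      rcases (h s ⟨hσI0.le.trans hs.1.le, hs.2⟩).2.2.1 with h1 | h1
      · exact absurd h1 (not_le.2 hs.1)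
      · exact h1
  -- the maximal time
  have hmem := Literature.Analysis.ODE.maximalTimeP_mem
    (P := fun σ => -(1 / 2) ≤ bp σ ∧ bp σ ≤ 9 / 10 ∧ (σ ≤ σI ∨ bp σ ≤ 2 / 5) ∧
      m1 σ ≤ μ + 3 * Real.sqrt B ∧ κ * ∫ u in (0 : ℝ)..σ, (wp u) ^ 2 ≤ 1) hT0 hP0
  have hspec := fun (t : ℝ) ht => Literature.Analysis.ODE.maximalTimeP_spec
    (P := fun σ => -(1 / 2) ≤ bp σ ∧ bp σ ≤ 9 / 10 ∧ (σ ≤ σI ∨ bp σ ≤ 2 / 5) ∧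
      m1 σ ≤ μ + 3 * Real.sqrt B ∧ κ * ∫ u in (0 : ℝ)..σ, (wp u) ^ 2 ≤ 1) hT0 hP0 hclosed
      (t := t) ht
  rcases Literature.Analysis.ODE.maximalTimeP_exit
    (P := fun σ => -(1 / 2) ≤ bp σ ∧ bp σ ≤ 9 / 10 ∧ (σ ≤ σI ∨ bp σ ≤ 2 / 5) ∧
      m1 σ ≤ μ + 3 * Real.sqrt B ∧ κ * ∫ u in (0 : ℝ)..σ, (wp u) ^ 2 ≤ 1) hT0 hP0 with h | h
  · intro σ hσ
    exact hspec σ ⟨hσ.1, h.symm ▸ hσ.2⟩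
  · exfalso
    refine h ?_
    generalize Literature.Analysis.ODE.maximalTimeP
      (fun σ => -(1 / 2) ≤ bp σ ∧ bp σ ≤ 9 / 10 ∧ (σ ≤ σI ∨ bp σ ≤ 2 / 5) ∧
        m1 σ ≤ μ + 3 * Real.sqrt B ∧ κ * ∫ u in (0 : ℝ)..σ, (wp u) ^ 2 ≤ 1) 0 T = ts
      at hmem hspec ⊢
    -- the sharp bounds on `[0, ts]`
    have hlo := prevPair_bp_lower hκq hsm hBT hΛ hcont hode herr henv hini hmem hspec
      ⟨hmem.1, le_rfl⟩
    have hup := prevPair_bp_upper hκq hsm hBT hΛ hcont hode herr henv hini hmem hspec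
      ⟨hmem.1, le_rfl⟩
    have hm1 := prevPair_m1 hκq hsm hBT hΛ hcont hode herr henv hini hmem hspec
      ⟨hmem.1, le_rfl⟩
    have hQ := prevPair_Q_sharp hκq hsm hBT hΛ hcont hode herr henv hini hmem hspec
      ⟨hmem.1, le_rfl⟩
    have hcb : ContinuousWithinAt bp (Icc 0 T) ts := hbpc ts hmem
    have hcm : ContinuousWithinAt m1 (Icc 0 T) ts := hm1c ts hmem
    have hcQ : ContinuousWithinAt (fun t => κ * ∫ u in (0 : ℝ)..t, (wp u) ^ 2) (Icc 0 T) ts :=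
      hQc ts hmem
    have e1 : ∀ᶠ t in 𝓝[Icc 0 T] ts, -(1 / 2) < bp t :=
      hcb.eventually_const_lt (by linarith only [hlo])
    have e2 : ∀ᶠ t in 𝓝[Icc 0 T] ts, bp t < 9 / 10 :=
      hcb.eventually_lt_const (by linarith only [hup])
    have e4 : ∀ᶠ t in 𝓝[Icc 0 T] ts, m1 t < μ + 3 * Real.sqrt B :=
      hcm.eventually_lt_const (by linarith only [hm1, hsq])
    have e5 : ∀ᶠ t in 𝓝[Icc 0 T] ts, κ * ∫ u in (0 : ℝ)..t, (wp u) ^ 2 < 1 :=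
      hcQ.eventually_lt_const (by linarith only [hQ])
    have e3 : ∀ᶠ t in 𝓝[Icc 0 T] ts, t ≤ σI ∨ bp t ≤ 2 / 5 := by
      rcases lt_or_ge ts σI with h1 | h1
      · exact Filter.eventually_of_mem (mem_nhdsWithin_of_mem_nhds (Iio_mem_nhds h1))
          fun t ht => Or.inl (le_of_lt ht)
      · have haft := prevPair_bp_after hκq hsm hBT hΛ hcont hode herr henv hini hmem hspec
          ⟨h1, le_rfl⟩
        exact (hcb.eventually_lt_const (by linarith only [haft] : bp ts < 2 / 5)).mono
          fun t ht => Or.inr ht.le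
    exact ((((e1.and e2).and e3).and e4).and e5).mono
      fun t ⟨⟨⟨⟨h1, h2⟩, h3⟩, h4⟩, h5⟩ => ⟨h1.le, h2.le, h3, h4.le, h5.le⟩

/-- **The core of the stub `previousPair` on a horizon `T`**: conclusions (A), (B), (C) of the
registered stub on `[0, T]`, `[σI, T]`, `[0, T]` (from the tube on `[0, T]` and the sharp
estimates). [folklore] -/
theorem prevPair_core :
    (∀ σ ∈ Icc 0 T, -ω ≤ wp σ ∧ (wp σ) ^ 2 ≤ q ^ 3 * B + 2 ∧ -(2 / 5) ≤ bp σ ∧ bp σ ≤ 17 / 20) ∧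
    (∀ σ ∈ Icc σI T, |wp σ| ≤ ω / 2 ∧ bp σ ≤ 3 / 10) ∧
    (∀ σ ∈ Icc 0 T, κ * ∫ u in (0 : ℝ)..σ, (wp u) ^ 2 ≤ 9 / 10) := by
  have htube := prevPair_tube hκq hsm hBT hΛ hcont hode herr henv hini
  have hT0 : (0 : ℝ) ≤ T := hBT.2.2.2.1.le
  have hB : 1000 ≤ B := hBT.1
  have hσI0 : 0 < σI := hBT.2.1
  have hTT : T ∈ Icc 0 T := ⟨hT0, le_rfl⟩
  have hεω := hsm.2.2.1
  have hω := hsm.2.2.2.1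
  have hω0 : 0 ≤ ω := by linarith only [hsm.2.1, hεω]
  refine ⟨fun σ hσ => ⟨?_, ?_, ?_, ?_⟩, fun σ hσ => ⟨?_, ?_⟩, fun σ hσ => ?_⟩
  · rcases le_or_gt σ σI with h | h
    · have := (prevPair_wp_front hκq hsm hBT hΛ hcont hode herr henv hini hTT htube hσ h).2
      have hc : 25 * ω / (4 * B) ≤ ω := by
        rw [div_le_iff₀ (by linarith only [hB])]; nlinarith only [hω0, hB]
      linarith only [this, hc]
    · have := prevPair_wp_after hκq hsm hBT hΛ hcont hode herr henv hini hTT htube ⟨h.le, hσ.2⟩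
      nlinarith only [this, hω0]
  · have := prevPair_wp_sq hκq hsm hBT hΛ hcont hode herr henv hini hTT htube hσ
    nlinarith only [this, hini.2.2.2.2.1, hω, hω0]
  · linarith only [prevPair_bp_lower hκq hsm hBT hΛ hcont hode herr henv hini hTT htube hσ]
  · linarith only [prevPair_bp_upper hκq hsm hBT hΛ hcont hode herr henv hini hTT htube hσ]
  · have := prevPair_wp_after hκq hsm hBT hΛ hcont hode herr henv hini hTT htube hσ
    exact abs_le_of_sq_le_sq (by linarith only [this]) (by positivity)
  · linarith only [prevPair_bp_after hκq hsm hBT hΛ hcont hode herr henv hini hTT htube hσ]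
  · linarith only [prevPair_Q_sharp hκq hsm hBT hΛ hcont hode herr henv hini hTT htube hσ]

end Core

/-- **Registered stub `stub_previousPair`** (G4', line `Sketch` of crux
`PerpetualPump.AveragedTypeIBlowup`, stmt-NavierStokesRegularity-1835). The pair just behind the
front after a hand-off: the spent bond `wp` (with `wp² = q³B ± 1` at the hand-off) DUMPS its
energy forward while the new front carrier is still `≈ B e^{-σ}` (decay rate `≈ κ B/q`),
lowering the previous carrier `bp` from `q⁴/2 + (P−R)/2` by `≈ q⁴/2` (so `κ∫wp² ≤ 9/10`), after
which `|wp| ≤ ω/2`, `bp ≤ 3/10`, and `bp ≥ −2/5` throughout. Memory errors via Duhamel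
majorants with the budget `η(μ + 2√B) ≤ ω/10`. [folklore] -/
theorem stub_previousPair :
    ∀ (bp wp b m0 m1 wl e0 e1 : ℝ → ℝ) (B Λ κ q θ η εb ω μ σI σ₁ : ℝ),
      4 / 5 ≤ κ → κ ≤ 1 → 1 ≤ q → q ≤ 21 / 20 → 1 / 2 ≤ θ → θ ≤ 1 → 0 ≤ η → 0 < εb →
      10 * εb ≤ ω → ω ≤ 1 / 100 → 0 ≤ μ → η * (μ + 2 * Real.sqrt B) ≤ ω / 10 → η * μ ≤ 1 / 20 →
      1000 ≤ B → 0 < σI → σI ≤ 3 → σI ≤ σ₁ → σ₁ ≤ 10 → 100 ≤ Λ → Λ ≤ B * (1 - Real.exp (-σI)) →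
      11 * Real.sqrt B * Real.exp (-(κ * Λ / 3)) ≤ ω →
      ContinuousOn bp (Icc 0 σ₁) → ContinuousOn wp (Icc 0 σ₁) → ContinuousOn b (Icc 0 σ₁) →
      ContinuousOn m0 (Icc 0 σ₁) → ContinuousOn m1 (Icc 0 σ₁) → ContinuousOn wl (Icc 0 σ₁) →
      ContinuousOn e0 (Icc 0 σ₁) → ContinuousOn e1 (Icc 0 σ₁) →
      (∀ σ ∈ Ioo 0 σ₁, HasDerivAt bp
        (κ * (-(bp σ) - (wp σ) ^ 2 + (wl σ) ^ 2 - εb * bp σ * wp σ) + e0 σ) σ) →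
      (∀ σ ∈ Ioo 0 σ₁, HasDerivAt wp
        (κ * (wp σ * (bp σ - b σ / q - 1) + εb * (bp σ) ^ 2) + e1 σ) σ) →
      (∀ σ ∈ Icc 0 σ₁, |e0 σ| ≤ η * κ * m0 σ) → (∀ σ ∈ Icc 0 σ₁, |e1 σ| ≤ η * κ * m1 σ) →
      (∀ σ ∈ Icc 0 σ₁, 0 ≤ m0 σ ∧ m0 σ ≤ m0 0 * Real.exp (-(θ * κ * σ)) +
        κ * ∫ u in (0 : ℝ)..σ, Real.exp (-(θ * κ * (σ - u))) * |-(wp u) ^ 2 + (wl u) ^ 2 - εb * bp u * wp u|) →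
      (∀ σ ∈ Icc 0 σ₁, 0 ≤ m1 σ ∧ m1 σ ≤ m1 0 * Real.exp (-(θ * κ * σ)) +
        κ * ∫ u in (0 : ℝ)..σ, Real.exp (-(θ * κ * (σ - u))) * |wp u * (bp u - b u / q) + εb * (bp u) ^ 2|) →
      (∀ σ ∈ Icc 0 σ₁, |wl σ| ≤ ω) →
      (∀ σ ∈ Icc 0 σI, B * Real.exp (-σ) - 3 ≤ b σ) → (∀ σ ∈ Icc 0 σ₁, -(1 / 2) ≤ b σ ∧ b σ ≤ B + 3) →
      q ^ 4 / 2 - 3 / 20 ≤ bp 0 → bp 0 ≤ q ^ 4 / 2 + 1 / 10 → 0 ≤ wp 0 →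
      q ^ 3 * B - 1 ≤ (wp 0) ^ 2 → (wp 0) ^ 2 ≤ q ^ 3 * B + 1 → m0 0 ≤ μ → m1 0 ≤ μ →
      (∀ σ ∈ Icc 0 σ₁, -ω ≤ wp σ ∧ (wp σ) ^ 2 ≤ q ^ 3 * B + 2 ∧ -(2 / 5) ≤ bp σ ∧ bp σ ≤ 17 / 20) ∧
      (∀ σ ∈ Icc σI σ₁, |wp σ| ≤ ω / 2 ∧ bp σ ≤ 3 / 10) ∧
      (∀ σ ∈ Icc 0 σ₁, κ * ∫ u in (0 : ℝ)..σ, (wp u) ^ 2 ≤ 9 / 10) := by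
  intro bp wp b m0 m1 wl e0 e1 B Λ κ q θ η εb ω μ σI σ₁ hκ0 hκ1 hq1 hq2 hθ1 hθ2 hη hεb hεω hω hμ
    hημB hημ hB hσI0 hσI3 hσI1 hσ₁ hΛ1 hΛ2 hdec hbp hwp hb hm0 hm1 hwl he0 he1 hode0 hode1 herr0
    herr1 hmem0 hmem1 hwlb hfront hbb hbp0l hbp0u hwp0 hwp0l hwp0u hm00 hm10
  exact prevPair_core (T := σ₁) ⟨hκ0, hκ1, hq1, hq2⟩ ⟨hη, hεb, hεω, hω, hμ, hημB, hημ, hθ1, hθ2⟩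
    ⟨hB, hσI0, hσI3, hσI0.trans_le hσI1, hσ₁⟩ ⟨hΛ1, hΛ2, hdec⟩
    ⟨hbp, hwp, hb, hm0, hm1, hwl, he0, he1⟩ ⟨hode0, hode1⟩ ⟨herr0, herr1, hmem0, hmem1⟩
    ⟨hwlb, fun σ hσ => hfront σ ⟨hσ.1, hσ.2.trans (min_le_right _ _)⟩, hbb⟩
    ⟨hbp0l, hbp0u, hwp0, hwp0l, hwp0u, hm00, hm10⟩

/-- **Truncated companion `stub_previousPairTrunc`** of `stub_previousPair` (for the continuation
argument, where the chain solution is only known up to a horizon `T`): the same statement with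
all dynamical hypotheses given on `[0, T]` (`0 < T ≤ σ₁`), the front hypothesis on
`[0, min T σI]`, and the conclusions (A), (C) on `[0, T]`, (B) on `[σI, T]` (vacuous if `T < σI`).
This is literally the internal bootstrap `prevPair_core`. [folklore] -/
theorem stub_previousPairTrunc :
    ∀ (bp wp b m0 m1 wl e0 e1 : ℝ → ℝ) (B Λ κ q θ η εb ω μ σI σ₁ T : ℝ),
      4 / 5 ≤ κ → κ ≤ 1 → 1 ≤ q → q ≤ 21 / 20 → 1 / 2 ≤ θ → θ ≤ 1 → 0 ≤ η → 0 < εb →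
      10 * εb ≤ ω → ω ≤ 1 / 100 → 0 ≤ μ → η * (μ + 2 * Real.sqrt B) ≤ ω / 10 → η * μ ≤ 1 / 20 →
      1000 ≤ B → 0 < σI → σI ≤ 3 → σI ≤ σ₁ → σ₁ ≤ 10 → 0 < T → T ≤ σ₁ →
      100 ≤ Λ → Λ ≤ B * (1 - Real.exp (-σI)) →
      11 * Real.sqrt B * Real.exp (-(κ * Λ / 3)) ≤ ω →
      ContinuousOn bp (Icc 0 T) → ContinuousOn wp (Icc 0 T) → ContinuousOn b (Icc 0 T) →
      ContinuousOn m0 (Icc 0 T) → ContinuousOn m1 (Icc 0 T) → ContinuousOn wl (Icc 0 T) →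
      ContinuousOn e0 (Icc 0 T) → ContinuousOn e1 (Icc 0 T) →
      (∀ σ ∈ Ioo 0 T, HasDerivAt bp
        (κ * (-(bp σ) - (wp σ) ^ 2 + (wl σ) ^ 2 - εb * bp σ * wp σ) + e0 σ) σ) →
      (∀ σ ∈ Ioo 0 T, HasDerivAt wp
        (κ * (wp σ * (bp σ - b σ / q - 1) + εb * (bp σ) ^ 2) + e1 σ) σ) →
      (∀ σ ∈ Icc 0 T, |e0 σ| ≤ η * κ * m0 σ) → (∀ σ ∈ Icc 0 T, |e1 σ| ≤ η * κ * m1 σ) →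
      (∀ σ ∈ Icc 0 T, 0 ≤ m0 σ ∧ m0 σ ≤ m0 0 * Real.exp (-(θ * κ * σ)) +
        κ * ∫ u in (0 : ℝ)..σ, Real.exp (-(θ * κ * (σ - u))) * |-(wp u) ^ 2 + (wl u) ^ 2 - εb * bp u * wp u|) →
      (∀ σ ∈ Icc 0 T, 0 ≤ m1 σ ∧ m1 σ ≤ m1 0 * Real.exp (-(θ * κ * σ)) +
        κ * ∫ u in (0 : ℝ)..σ, Real.exp (-(θ * κ * (σ - u))) * |wp u * (bp u - b u / q) + εb * (bp u) ^ 2|) →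
      (∀ σ ∈ Icc 0 T, |wl σ| ≤ ω) →
      (∀ σ ∈ Icc 0 (min T σI), B * Real.exp (-σ) - 3 ≤ b σ) →
      (∀ σ ∈ Icc 0 T, -(1 / 2) ≤ b σ ∧ b σ ≤ B + 3) →
      q ^ 4 / 2 - 3 / 20 ≤ bp 0 → bp 0 ≤ q ^ 4 / 2 + 1 / 10 → 0 ≤ wp 0 →
      q ^ 3 * B - 1 ≤ (wp 0) ^ 2 → (wp 0) ^ 2 ≤ q ^ 3 * B + 1 → m0 0 ≤ μ → m1 0 ≤ μ →
      (∀ σ ∈ Icc 0 T, -ω ≤ wp σ ∧ (wp σ) ^ 2 ≤ q ^ 3 * B + 2 ∧ -(2 / 5) ≤ bp σ ∧ bp σ ≤ 17 / 20) ∧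
      (∀ σ ∈ Icc σI T, |wp σ| ≤ ω / 2 ∧ bp σ ≤ 3 / 10) ∧
      (∀ σ ∈ Icc 0 T, κ * ∫ u in (0 : ℝ)..σ, (wp u) ^ 2 ≤ 9 / 10) := by
  intro bp wp b m0 m1 wl e0 e1 B Λ κ q θ η εb ω μ σI σ₁ T hκ0 hκ1 hq1 hq2 hθ1 hθ2 hη hεb hεω hω hμ
    hημB hημ hB hσI0 hσI3 _ hσ₁ hT0 hT1 hΛ1 hΛ2 hdec hbp hwp hb hm0 hm1 hwl he0 he1 hode0 hode1
    herr0 herr1 hmem0 hmem1 hwlb hfront hbb hbp0l hbp0u hwp0 hwp0l hwp0u hm00 hm10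
  exact prevPair_core ⟨hκ0, hκ1, hq1, hq2⟩ ⟨hη, hεb, hεω, hω, hμ, hημB, hημ, hθ1, hθ2⟩
    ⟨hB, hσI0, hσI3, hT0, hT1.trans hσ₁⟩ ⟨hΛ1, hΛ2, hdec⟩
    ⟨hbp, hwp, hb, hm0, hm1, hwl, he0, he1⟩ ⟨hode0, hode1⟩ ⟨herr0, herr1, hmem0, hmem1⟩
    ⟨hwlb, hfront, hbb⟩ ⟨hbp0l, hbp0u, hwp0, hwp0l, hwp0u, hm00, hm10⟩

end Summit.NavierStokesRegularity.NavierStokesRegularity.Theorems.PerpetualPumpAveragedTypeIBlowup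

end
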